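import Summits.ResolutionOfSingularities.ResolutionOfSingularities.Theorems.FrobeniusClosingPatchingRelPerfectDepthPhaseCDetachedCylinder
import HarnessLib

/-!
# Crux `PatchingRelPerfect` (stmt-ResolutionOfSingularities-16161), chain W5.2 — F7(β) (β-AX) PHASE C,
# chart certificate C2′: the LINEAR TWO-PLANE POLE (common-trace pole) — both admissible disposals

[OURS · L1 W5.2 · F7(β) (β-AX) Phase C · res-L1-w52-plan-1 NAMING G11-7 (2) «(C2′) the linear two-plane pole» in the
REACHABLE normal form of res-L1-w52-tri-2 TRIAGE v11.3 Row N4 (γ) (kit j281963 «gamma»); RULE C3′ of RULING G11-6 (2)]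
res-L1-w52-stub-1 g5.  Replaces the role of NO printed item; NOT a statement of the manuscript under review (AI-written,
weaker than expert review).  MACHINE CHECK at ring level over an ARBITRARY commutative ring.

Frame.  Two regular hosts with linearly dependent tangent hyperplanes along a curve: `H₁ = V(x)`, `H₂ = V(x + t y)`
(`H₁ ∩ H₂ = V(x, t) ∪ V(x, y)`, the two planes), the exceptional member `E″ = V(t)` with exponent `2` and the
`N`-member `V(z)`:

  `K = (x) + (x + t y) + (z t²)`,  `cosupp K = V(x, t) ∪ V(x, y, z)`,  non-END locus `λ = V(x, y, t)` (tri-2 N4).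

* §1 (any commutative ring) `pole_eq`: `K = (x) + (t y) + (z t²)`; legality of both centres (`pole_le_surface`,
  `pole_le_line`).
  **ROUTE A — RULE C3′ (centre := the surface COMPONENT `V(x, t)` of `cosupp K` through `λ`)**: `t`-chart (`x = g x′`,
  `t = g`) `K = (g) · ((x′) + (x′ + y) + (z g))` and `(x′) + (x′ + y) + (z g) = (x′) + (y) + (z g)` (`surfaceT_K`,
  `surfaceT_end`): a monomial sum in the hosts `H₁′ = V(x′)`, `H₂′ = V(x′ + y)` and the members `V(z)`, `V(g)`, whose
  letters `{x′, x′ + y, z, g}` are the chart letters `{x′, y, z, g}` up to the unimodular exchange `y ↦ x′ + y` ⇒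
  **END IN ONE MOVE**; `x`-chart `K = (g)` (`surfaceX_K`).
  **ROUTE B — tri-2's repair (centre := the non-END locus `λ = V(x, y, t)` itself)**: `y`-chart `K = (g)·((x′) + (g t′))`
  END (`lineY_K`); `x`-chart `(g)` (`lineX_K`); `t`-chart `K = (g) · K_α`, `K_α = (x′) + (g y′) + (z g)` the private
  contact-one pole (`lineT_K`), disposed of by the blow-up of the line `V(x′, y′, z)`: charts `y′`, `z` give
  `(h) · ((x″) + (g))` END, chart `x′` gives `(h)` (`alphaY_K`, `alphaZ_K`, `alphaX_K`) ⇒ **END IN TWO MOVES**.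
* §2 the same identities for the images under the Rees chart maps of `Bl_{(x,t)}`, `Bl_{(x,y,t)}`, `Bl_{(x′,y′,z)}`
  (`map_pole_surface_*`, `map_pole_line_*`, `map_alpha_*`).
* §3 Route A's END is an snc presentation: `R` regular local with regular system of parameters `(x, t, y, z, w…)`; at a
  prime of the `t`-chart over `𝔪_R` containing `x/t`, the exchanged family `(t, x/t, x/t + y, z, w…)` is part of a
  regular system of parameters of `B_𝔓` (`isRsopPart_surfaceT_exchanged`).

Data point for X3 (PhaseC-Termination, G11-7 (3)): the component rule is SHORTER here (1 move) than the sub-stratum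
centre (2 moves).  Fact-free; design evidence only.  Not covered: poles with `N`-part in two old members, (α_m) for
`m ≥ 2`, curve-poles (stub-2 T2″), termination in general.

## References
* The Stacks Project, Tags 0804, 0BIQ (affine blow-up algebras and their charts). [StacksProject]
* A. J. de Jong, *Smoothness, semi-stability and alterations*, Publ. Math. IHÉS 83 (1996), 2.4. [DeJong1996]
* J. Kollár, *Lectures on Resolution of Singularities* (2007), (3.111) Step 3 (monomial bookkeeping). [Kollar2007]
-/

-- `Summit.<Summit>.<Sub>.Theorems` with `Sub = Summit` (single-conjunct summit, D-0017)
set_option linter.dupNamespace false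

noncomputable section

open IsLocalRing Literature.AlgebraicGeometry.Resolution

namespace Summit.ResolutionOfSingularities.ResolutionOfSingularities.Theorems

universe u

namespace DepthPhaseC

/-- The common-trace pole `K = (x) + (x + t y) + (z t²)`. -/
local notation3 "Kp[" x "," y "," z "," t "]" => (Ideal.span {x} ⊔ Ideal.span {x + t * y} ⊔ Ideal.span {z * t ^ 2})
/-- The private contact-one pole `K_α = (x′) + (g y′) + (z g)` met on the `t`-chart of Route B. -/
local notation3 "Ka[" x "," y "," z "," g "]" => (Ideal.span {x} ⊔ Ideal.span {g * y} ⊔ Ideal.span {z * g})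

/-! ## §1 The algebra of the moves -/

section Algebra

variable {A : Type u} [CommRing A]

/-- `K = (x) + (t y) + (z t²)`. [folklore] -/
theorem pole_eq (x y z t : A) : Kp[x, y, z, t] = Ideal.span {x} ⊔ Ideal.span {t * y} ⊔ Ideal.span {z * t ^ 2} := by
  rw [sup_right_comm _ (Ideal.span {x + t * y}), sup_right_comm _ (Ideal.span {t * y})]
  refine sup_span_singleton_congr ?_
  rw [add_sub_cancel_right]
  exact Ideal.mem_sup_left (Ideal.mem_span_singleton_self x)

/-- **Legality of Route A (`ν = 1`)**: `K ≤ (x, t)`. [folklore] -/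
theorem pole_le_surface (x y z t : A) : Kp[x, y, z, t] ≤ Ideal.span (Set.range ![x, t]) := by
  rw [CuspMember.span_range_vec2]
  refine sup_le (sup_le le_sup_left ?_) ?_ <;> rw [Ideal.span_singleton_le_iff_mem]
  · exact Ideal.add_mem _ (Ideal.mem_sup_left (Ideal.mem_span_singleton_self x))
      (Ideal.mem_sup_right (Ideal.mul_mem_right _ _ (Ideal.mem_span_singleton_self t)))
  · exact Ideal.mem_sup_right (Ideal.mem_span_singleton.mpr ⟨z * t, by ring⟩)

/-- **Legality of Route B (`ν = 1`)**: `K ≤ (x, y, t)`. [folklore] -/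
theorem pole_le_line (x y z t : A) : Kp[x, y, z, t] ≤ Ideal.span (Set.range ![x, y, t]) := by
  rw [CuspMember.span_range_vec3]
  refine sup_le (sup_le (le_sup_of_le_left le_sup_left) ?_) ?_ <;> rw [Ideal.span_singleton_le_iff_mem]
  · exact Ideal.add_mem _ (Ideal.mem_sup_left (Ideal.mem_sup_left (Ideal.mem_span_singleton_self x)))
      (Ideal.mem_sup_right (Ideal.mul_mem_right _ _ (Ideal.mem_span_singleton_self t)))
  · exact Ideal.mem_sup_right (Ideal.mem_span_singleton.mpr ⟨z * t, by ring⟩)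

/-! ### Route A: the surface component `V(x, t)` -/

/-- **Route A, `t`-chart** (`x = g x′`, `t = g`): `K = (g) · ((x′) + (x′ + y) + (z g))`. [folklore] -/
theorem surfaceT_K (x' y z g : A) :
    Kp[g * x', y, z, g] = Ideal.span {g} * (Ideal.span {x'} ⊔ Ideal.span {x' + y} ⊔ Ideal.span {z * g}) := by
  rw [span_singleton_mul_sup₃, show g * x' + g * y = g * (x' + y) by ring, show z * g ^ 2 = g * (z * g) by ring]

/-- **Route A END**: `(x′) + (x′ + y) + (z g) = (x′) + (y) + (z g)` — a monomial sum in the members `H₁′, H₂′, V(z), V(g)`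
(letters `x′, x′ + y, z, g`), equivalently in the chart letters `x′, y, z, g`. [cite: Kollar2007, (3.111) Step 3] -/
theorem surfaceT_end (x' y z g : A) :
    Ideal.span {x'} ⊔ Ideal.span {x' + y} ⊔ Ideal.span {z * g} = Ideal.span {x'} ⊔ Ideal.span {y} ⊔ Ideal.span {z * g} := by
  rw [sup_right_comm _ (Ideal.span {x' + y}), sup_right_comm _ (Ideal.span {y})]
  refine sup_span_singleton_congr ?_
  rw [add_sub_cancel_right]
  exact Ideal.mem_sup_left (Ideal.mem_span_singleton_self x')

/-- **Route A, `x`-chart** (`x = g`, `t = g t′`): `K = (g)`. [folklore] -/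
theorem surfaceX_K (y z t' g : A) : Kp[g, y, z, g * t'] = Ideal.span {g} := by
  refine le_antisymm (sup_le (sup_le le_rfl ?_) ?_) (le_sup_of_le_left le_sup_left) <;>
    rw [Ideal.span_singleton_le_iff_mem]
  · exact Ideal.mem_span_singleton.mpr ⟨1 + t' * y, by ring⟩
  · exact Ideal.mem_span_singleton.mpr ⟨z * g * t' ^ 2, by ring⟩

/-! ### Route B: the non-END locus `λ = V(x, y, t)`, then the private pole -/

/-- **Route B, `y`-chart** (`x = g x′`, `y = g`, `t = g t′`): `K = (g) · ((x′) + (g t′))` — END (members `H₁′`, `G`, `E‴`).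
[folklore] -/
theorem lineY_K (x' z t' g : A) : Kp[g * x', g, z, g * t'] = Ideal.span {g} * (Ideal.span {x'} ⊔ Ideal.span {g * t'}) := by
  rw [Ideal.mul_sup, Ideal.span_singleton_mul_span_singleton, Ideal.span_singleton_mul_span_singleton]
  refine le_antisymm (sup_le (sup_le le_sup_left ?_) ?_) (sup_le (le_sup_of_le_left le_sup_left) ?_) <;>
    rw [Ideal.span_singleton_le_iff_mem]
  · exact Ideal.add_mem _ (Ideal.mem_sup_left (Ideal.mem_span_singleton_self _))
      (Ideal.mem_sup_right (Ideal.mem_span_singleton.mpr ⟨1, by ring⟩))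
  · exact Ideal.mem_sup_right (Ideal.mem_span_singleton.mpr ⟨z * t', by ring⟩)
  · have e : g * (g * t') = (g * x' + g * t' * g) - g * x' := by ring
    rw [e]
    exact Ideal.sub_mem _ (Ideal.mem_sup_left (Ideal.mem_sup_right (Ideal.mem_span_singleton_self _)))
      (Ideal.mem_sup_left (Ideal.mem_sup_left (Ideal.mem_span_singleton_self _)))

/-- **Route B, `x`-chart** (`x = g`, `y = g y′`, `t = g t′`): `K = (g)`. [folklore] -/
theorem lineX_K (y' z t' g : A) : Kp[g, g * y', z, g * t'] = Ideal.span {g} := by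
  refine le_antisymm (sup_le (sup_le le_rfl ?_) ?_) (le_sup_of_le_left le_sup_left) <;>
    rw [Ideal.span_singleton_le_iff_mem]
  · exact Ideal.mem_span_singleton.mpr ⟨1 + t' * g * y', by ring⟩
  · exact Ideal.mem_span_singleton.mpr ⟨z * g * t' ^ 2, by ring⟩

/-- **Route B, `t`-chart** (`x = g x′`, `y = g y′`, `t = g`): `K = (g) · K_α`, `K_α = (x′) + (g y′) + (z g)` — the private
contact-one pole (tri-2 N4: «of type (α)»). [folklore] -/
theorem lineT_K (x' y' z g : A) : Kp[g * x', g * y', z, g] = Ideal.span {g} * Ka[x', y', z, g] := by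
  rw [span_singleton_mul_sup₃, show z * g ^ 2 = g * (z * g) by ring, sup_right_comm _ (Ideal.span {g * x' + g * (g * y')}),
    sup_right_comm _ (Ideal.span {g * (g * y')})]
  refine sup_span_singleton_congr ?_
  rw [show g * x' + g * (g * y') - g * (g * y') = g * x' by ring]
  exact Ideal.mem_sup_left (Ideal.mem_span_singleton_self _)

/-- **Legality of the second move (`ν = 1`)**: `K_α ≤ (x′, y′, z)`. [folklore] -/
theorem alpha_le_line (x y z g : A) : Ka[x, y, z, g] ≤ Ideal.span (Set.range ![x, y, z]) := by
  rw [CuspMember.span_range_vec3]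
  refine sup_le (sup_le (le_sup_of_le_left le_sup_left) ?_) ?_ <;> rw [Ideal.span_singleton_le_iff_mem]
  · exact Ideal.mem_sup_left (Ideal.mem_sup_right (Ideal.mul_mem_left _ _ (Ideal.mem_span_singleton_self y)))
  · exact Ideal.mem_sup_right (Ideal.mul_mem_right _ _ (Ideal.mem_span_singleton_self z))

/-- **Second move, `y′`-chart** (`x′ = h x″`, `y′ = h`, `z = h z′`): `K_α = (h) · ((x″) + (g))` — END. [folklore] -/
theorem alphaY_K (x'' z' g h : A) : Ka[h * x'', h, h * z', g] = Ideal.span {h} * (Ideal.span {x''} ⊔ Ideal.span {g}) := by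
  rw [Ideal.mul_sup, Ideal.span_singleton_mul_span_singleton, Ideal.span_singleton_mul_span_singleton]
  refine le_antisymm (sup_le (sup_le le_sup_left ?_) ?_) (sup_le (le_sup_of_le_left le_sup_left) ?_) <;>
    rw [Ideal.span_singleton_le_iff_mem]
  · exact Ideal.mem_sup_right (Ideal.mem_span_singleton.mpr ⟨1, by ring⟩)
  · exact Ideal.mem_sup_right (Ideal.mem_span_singleton.mpr ⟨z', by ring⟩)
  · exact Ideal.mem_sup_left (Ideal.mem_sup_right (Ideal.mem_span_singleton.mpr ⟨1, by ring⟩))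

/-- **Second move, `z`-chart** (`x′ = h x″`, `y′ = h y″`, `z = h`): `K_α = (h) · ((x″) + (g))` — END. [folklore] -/
theorem alphaZ_K (x'' y'' g h : A) : Ka[h * x'', h * y'', h, g] = Ideal.span {h} * (Ideal.span {x''} ⊔ Ideal.span {g}) := by
  rw [Ideal.mul_sup, Ideal.span_singleton_mul_span_singleton, Ideal.span_singleton_mul_span_singleton]
  refine le_antisymm (sup_le (sup_le le_sup_left ?_) ?_) (sup_le (le_sup_of_le_left le_sup_left) ?_) <;>
    rw [Ideal.span_singleton_le_iff_mem]
  · exact Ideal.mem_sup_right (Ideal.mem_span_singleton.mpr ⟨y'', by ring⟩)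
  · exact Ideal.mem_sup_right (Ideal.mem_span_singleton.mpr ⟨1, by ring⟩)
  · exact Ideal.mem_sup_right (Ideal.mem_span_singleton.mpr ⟨1, by ring⟩)

/-- **Second move, `x′`-chart** (`x′ = h`, `y′ = h y″`, `z = h z′`): `K_α = (h)`. [folklore] -/
theorem alphaX_K (y'' z' g h : A) : Ka[h, h * y'', h * z', g] = Ideal.span {h} := by
  refine le_antisymm (sup_le (sup_le le_rfl ?_) ?_) (le_sup_of_le_left le_sup_left) <;>
    rw [Ideal.span_singleton_le_iff_mem]
  · exact Ideal.mem_span_singleton.mpr ⟨g * y'', by ring⟩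
  · exact Ideal.mem_span_singleton.mpr ⟨z' * g, by ring⟩

end Algebra

/-! ## §2 The images on the Rees charts -/

section Charts

variable {R : Type u} [CommRing R] (x y z t : R)

local notation3 "c₂" => (![x, t] : Fin 2 → R)
local notation3 "c₃" => (![x, y, t] : Fin 3 → R)
local notation3 "cα" => (![x, y, z] : Fin 3 → R)

set_option maxHeartbeats 400000 in
-- instance-path defeq through `HomogeneousLocalization`'s standalone `Pow`/`Mul` (as in p508825)
/-- **Route A, `t`-chart image**: `K · B_t = (t) · ((x/t) + (x/t + y) + (z t))`. [cite: StacksProject, Tag 0804] -/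
theorem map_pole_surface_one :
    (Kp[x, y, z, t]).map (chartBase c₂ 1) = Ideal.span {chartBase c₂ 1 t} *
      (Ideal.span {chartGen c₂ 1 0} ⊔ Ideal.span {chartGen c₂ 1 0 + chartBase c₂ 1 y} ⊔
        Ideal.span {chartBase c₂ 1 z * chartBase c₂ 1 t}) := by
  have cb : chartBase c₂ 1 x = chartBase c₂ 1 t * chartGen c₂ 1 0 := reesChartBase_apply_eq_mul_chartGen c₂ 1 0
  rw [map_sup₃, map_add, map_mul, map_mul, map_pow, cb]
  exact surfaceT_K _ _ _ _

set_option maxHeartbeats 400000 in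
-- instance-path defeq through `HomogeneousLocalization`'s standalone `Pow`/`Mul` (as in p508825)
/-- **Route A, `x`-chart image**: `K · B_x = (x)`. [cite: StacksProject, Tag 0804] -/
theorem map_pole_surface_zero : (Kp[x, y, z, t]).map (chartBase c₂ 0) = Ideal.span {chartBase c₂ 0 x} := by
  have cb : chartBase c₂ 0 t = chartBase c₂ 0 x * chartGen c₂ 0 1 := reesChartBase_apply_eq_mul_chartGen c₂ 0 1
  rw [map_sup₃, map_add, map_mul, map_mul, map_pow, cb]
  exact surfaceX_K _ _ _ _

set_option maxHeartbeats 400000 in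
-- instance-path defeq through `HomogeneousLocalization`'s standalone `Pow`/`Mul` (as in p508825)
/-- **Route B, `y`-chart image**: `K · B_y = (y) · ((x/y) + (y · t/y))`. [cite: StacksProject, Tag 0804] -/
theorem map_pole_line_one :
    (Kp[x, y, z, t]).map (chartBase c₃ 1) =
      Ideal.span {chartBase c₃ 1 y} * (Ideal.span {chartGen c₃ 1 0} ⊔ Ideal.span {chartBase c₃ 1 y * chartGen c₃ 1 2}) := by
  have cbx : chartBase c₃ 1 x = chartBase c₃ 1 y * chartGen c₃ 1 0 := reesChartBase_apply_eq_mul_chartGen c₃ 1 0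
  have cbt : chartBase c₃ 1 t = chartBase c₃ 1 y * chartGen c₃ 1 2 := reesChartBase_apply_eq_mul_chartGen c₃ 1 2
  rw [map_sup₃, map_add, map_mul, map_mul, map_pow, cbx, cbt]
  exact lineY_K _ _ _ _

set_option maxHeartbeats 400000 in
-- instance-path defeq through `HomogeneousLocalization`'s standalone `Pow`/`Mul` (as in p508825)
/-- **Route B, `x`-chart image**: `K · B_x = (x)`. [cite: StacksProject, Tag 0804] -/
theorem map_pole_line_zero : (Kp[x, y, z, t]).map (chartBase c₃ 0) = Ideal.span {chartBase c₃ 0 x} := by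
  have cby : chartBase c₃ 0 y = chartBase c₃ 0 x * chartGen c₃ 0 1 := reesChartBase_apply_eq_mul_chartGen c₃ 0 1
  have cbt : chartBase c₃ 0 t = chartBase c₃ 0 x * chartGen c₃ 0 2 := reesChartBase_apply_eq_mul_chartGen c₃ 0 2
  rw [map_sup₃, map_add, map_mul, map_mul, map_pow, cby, cbt]
  exact lineX_K _ _ _ _

set_option maxHeartbeats 400000 in
-- instance-path defeq through `HomogeneousLocalization`'s standalone `Pow`/`Mul` (as in p508825)
/-- **Route B, `t`-chart image**: `K · B_t = (t) · K_α(x/t, y/t, z, t)` — the private contact-one pole. [cite: StacksProject, Tag 0804] -/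
theorem map_pole_line_two :
    (Kp[x, y, z, t]).map (chartBase c₃ 2) =
      Ideal.span {chartBase c₃ 2 t} * Ka[chartGen c₃ 2 0, chartGen c₃ 2 1, chartBase c₃ 2 z, chartBase c₃ 2 t] := by
  have cbx : chartBase c₃ 2 x = chartBase c₃ 2 t * chartGen c₃ 2 0 := reesChartBase_apply_eq_mul_chartGen c₃ 2 0
  have cby : chartBase c₃ 2 y = chartBase c₃ 2 t * chartGen c₃ 2 1 := reesChartBase_apply_eq_mul_chartGen c₃ 2 1
  rw [map_sup₃, map_add, map_mul, map_mul, map_pow, cbx, cby]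
  exact lineT_K _ _ _ _

variable (g : R)

set_option maxHeartbeats 400000 in
-- instance-path defeq through `HomogeneousLocalization`'s standalone `Pow`/`Mul` (as in p508825)
/-- **Second move, `y′`-chart image**: `K_α · B_y = (y) · ((x/y) + (g))` — END. [cite: StacksProject, Tag 0804] -/
theorem map_alpha_one :
    (Ka[x, y, z, g]).map (chartBase cα 1) =
      Ideal.span {chartBase cα 1 y} * (Ideal.span {chartGen cα 1 0} ⊔ Ideal.span {chartBase cα 1 g}) := by
  have cbx : chartBase cα 1 x = chartBase cα 1 y * chartGen cα 1 0 := reesChartBase_apply_eq_mul_chartGen cα 1 0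
  have cbz : chartBase cα 1 z = chartBase cα 1 y * chartGen cα 1 2 := reesChartBase_apply_eq_mul_chartGen cα 1 2
  rw [map_sup₃, map_mul, map_mul, cbx, cbz]
  exact alphaY_K _ _ _ _

set_option maxHeartbeats 400000 in
-- instance-path defeq through `HomogeneousLocalization`'s standalone `Pow`/`Mul` (as in p508825)
/-- **Second move, `z`-chart image**: `K_α · B_z = (z) · ((x/z) + (g))` — END. [cite: StacksProject, Tag 0804] -/
theorem map_alpha_two :
    (Ka[x, y, z, g]).map (chartBase cα 2) =
      Ideal.span {chartBase cα 2 z} * (Ideal.span {chartGen cα 2 0} ⊔ Ideal.span {chartBase cα 2 g}) := by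
  have cbx : chartBase cα 2 x = chartBase cα 2 z * chartGen cα 2 0 := reesChartBase_apply_eq_mul_chartGen cα 2 0
  have cby : chartBase cα 2 y = chartBase cα 2 z * chartGen cα 2 1 := reesChartBase_apply_eq_mul_chartGen cα 2 1
  rw [map_sup₃, map_mul, map_mul, cbx, cby]
  exact alphaZ_K _ _ _ _

set_option maxHeartbeats 400000 in
-- instance-path defeq through `HomogeneousLocalization`'s standalone `Pow`/`Mul` (as in p508825)
/-- **Second move, `x′`-chart image**: `K_α · B_x = (x)`. [cite: StacksProject, Tag 0804] -/
theorem map_alpha_zero : (Ka[x, y, z, g]).map (chartBase cα 0) = Ideal.span {chartBase cα 0 x} := by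
  have cby : chartBase cα 0 y = chartBase cα 0 x * chartGen cα 0 1 := reesChartBase_apply_eq_mul_chartGen cα 0 1
  have cbz : chartBase cα 0 z = chartBase cα 0 x * chartGen cα 0 2 := reesChartBase_apply_eq_mul_chartGen cα 0 2
  rw [map_sup₃, map_mul, map_mul, cby, cbz]
  exact alphaX_K _ _ _ _

end Charts

/-! ## §3 Route A's END at the local rings of the `t`-chart over the closed point -/

section Local

variable {R : Type u} [CommRing R] [IsRegularLocalRing R] (x t y z : R) {l : ℕ} (w : Fin l → R)
  (hz : Ideal.span (Set.range (Fin.append ![x, t] (Fin.cons y (Fin.cons z w) : Fin (l + 1 + 1) → R))) =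
    maximalIdeal R)
  (hd : (maximalIdeal R).spanFinrank = 2 + (l + 1 + 1))
  (𝔓 : Ideal (chartRing (![x, t] : Fin 2 → R) 1)) [𝔓.IsPrime]
  (h𝔓 : 𝔓.comap (chartBase (![x, t] : Fin 2 → R) 1) = maximalIdeal R)
  (L : Type u) [CommRing L] [IsLocalRing L] [Algebra (chartRing (![x, t] : Fin 2 → R) 1) L]
  [IsLocalization.AtPrime L 𝔓]

local notation3 "c₂" => (![x, t] : Fin 2 → R)
local notation3 "yzw" => (Fin.cons y (Fin.cons z w) : Fin (l + 1 + 1) → R)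
-- the localisation map `B → L = B_𝔓`, type-ascribed (see `…DepthPhaseCDetachedCylinder` §3)
local notation3 "φL" => (algebraMap (chartRing (![x, t] : Fin 2 → R) 1) L : chartRing (![x, t] : Fin 2 → R) 1 →+* L)
/-- The enumeration `(x/t)` of the chart generator other than `t/t`. -/
local notation3 "j0" => (![⟨0, by decide⟩] : Fin 1 → {j : Fin 2 // j ≠ 1})

omit [IsRegularLocalRing R] [𝔓.IsPrime] [IsLocalRing L] [IsLocalization.AtPrime L 𝔓] in
/-- The chart family `(t, x/t, y, z, w…)` of `…BlowupChartRsop`, unfolded. [folklore] -/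
theorem chartFamily_surface_eq :
    chartFamily c₂ 1 yzw L (chartBase c₂ 1) (chartGen c₂ 1) j0 =
      Fin.cons (φL (chartBase c₂ 1 t)) (Fin.append ![φL (chartGen c₂ 1 0)] fun k => φL (chartBase c₂ 1 (yzw k))) := by
  have hf : (fun k : Fin 1 => φL (chartGen c₂ 1 (j0 k).1)) = ![φL (chartGen c₂ 1 0)] := by
    funext k
    fin_cases k
    rfl
  unfold chartFamily
  rw [← hf]
  rfl

omit [IsRegularLocalRing R] [𝔓.IsPrime] [IsLocalRing L] [IsLocalization.AtPrime L 𝔓] in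
/-- `range (Fin.append u v) = range u ∪ range v`. [folklore] -/
private theorem range_fin_append' {α : Type*} {m k : ℕ} (u : Fin m → α) (v : Fin k → α) :
    Set.range (Fin.append u v) = Set.range u ∪ Set.range v := by
  ext a
  constructor
  · rintro ⟨i, rfl⟩
    induction i using Fin.addCases with
    | left j => exact Or.inl ⟨j, by simp⟩
    | right j => exact Or.inr ⟨j, by simp⟩
  · rintro (⟨j, rfl⟩ | ⟨j, rfl⟩)
    · exact ⟨Fin.castAdd k j, by simp⟩
    · exact ⟨Fin.natAdd m j, by simp⟩

include hz hd h𝔓 in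
/-- [OURS · L1 W5.2 · (β-AX) Phase C · C2′] **Route A's END is an snc presentation.** `R` regular local with regular system
of parameters `(x, t, y, z, w…)`; at a prime `𝔓` of the `t`-chart of `Bl_{(x,t)} Spec R` over `𝔪_R` containing `x/t`, the
EXCHANGED family `(t, x/t, x/t + y, z, w…)` — the letters of the members `G`, `H₁′`, `H₂′`, `V(z)`, … — is part of a
regular system of parameters of `L = B_𝔓`.  [cite: DeJong1996, 2.4] [cite: StacksProject, Tag 0BIQ] -/
theorem isRsopPart_surfaceT_exchanged (h0 : chartGen c₂ 1 0 ∈ 𝔓) :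
    IsRsopPart (Fin.cons (φL (chartBase c₂ 1 t)) (Fin.append ![φL (chartGen c₂ 1 0)]
      (Fin.cons (φL (chartGen c₂ 1 0) + φL (chartBase c₂ 1 y))
        fun k => φL (chartBase c₂ 1 ((Fin.cons z w : Fin (l + 1) → R) k)))) : Fin (1 + (l + 1 + 1) + 1) → L) := by
  have hrsop := isRsopPart_chartFamily_reesChart c₂ 1 yzw hz hd 𝔓 h𝔓 L j0
    (Function.injective_of_subsingleton _) (fun k => by fin_cases k; exact h0)
  rw [chartFamily_surface_eq] at hrsop
  refine hrsop.of_span_range_eq ?_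
  -- the old tail `k ↦ φL (yzw k)` is `Fin.cons (φL y) (k ↦ φL ((z, w…) k))`
  have htail : (fun k => φL (chartBase c₂ 1 (yzw k))) =
      Fin.cons (φL (chartBase c₂ 1 y)) fun k => φL (chartBase c₂ 1 ((Fin.cons z w : Fin (l + 1) → R) k)) := by
    funext k
    induction k using Fin.cases with
    | zero => rfl
    | succ j => rfl
  rw [htail]
  simp only [Fin.range_cons, range_fin_append', Matrix.range_cons, Matrix.range_empty, Set.union_empty,
    Ideal.span_insert, Ideal.span_union]
  -- `(x′) + ((x′ + y) + rest) = (x′) + ((y) + rest)`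
  congr 1
  rw [← sup_assoc, ← sup_assoc, sup_comm (Ideal.span {φL (chartGen c₂ 1 0)}) (Ideal.span {_ + _}),
    sup_comm (Ideal.span {φL (chartGen c₂ 1 0)}) (Ideal.span {φL (chartBase c₂ 1 y)})]
  congr 1
  rw [sup_comm, sup_comm (Ideal.span {φL (chartBase c₂ 1 y)})]
  refine sup_span_singleton_congr ?_
  rw [add_sub_cancel_right]
  exact Ideal.mem_span_singleton_self _

omit [IsRegularLocalRing R] [𝔓.IsPrime] [IsLocalRing L] [IsLocalization.AtPrime L 𝔓] in
/-- **Route A in `L`**: `K L = (t) · ((x/t) + (x/t + y) + (z t))`, a monomial sum in the exchanged family.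
[cite: StacksProject, Tag 0804] -/
theorem map_pole_surface_one_local :
    (Kp[x, y, z, t]).map (RingHom.comp φL (chartBase c₂ 1)) = Ideal.span {φL (chartBase c₂ 1 t)} *
      (Ideal.span {φL (chartGen c₂ 1 0)} ⊔ Ideal.span {φL (chartGen c₂ 1 0) + φL (chartBase c₂ 1 y)} ⊔
        Ideal.span {φL (chartBase c₂ 1 z) * φL (chartBase c₂ 1 t)}) := by
  have e1 : φL (chartGen c₂ 1 0 + chartBase c₂ 1 y) = φL (chartGen c₂ 1 0) + φL (chartBase c₂ 1 y) :=
    map_add φL (chartGen c₂ 1 0) (chartBase c₂ 1 y)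
  have e2 : φL (chartBase c₂ 1 z * chartBase c₂ 1 t) = φL (chartBase c₂ 1 z) * φL (chartBase c₂ 1 t) :=
    map_mul φL (chartBase c₂ 1 z) (chartBase c₂ 1 t)
  rw [← Ideal.map_map, map_pole_surface_one, Ideal.map_mul, CuspMember.map_span_singleton, map_sup₃, e1, e2]

end Local

end DepthPhaseC

end Summit.ResolutionOfSingularities.ResolutionOfSingularities.Theorems

end
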